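import Literature.MathematicalPhysics.QuantumLattice.DWaveSourceWindowCertificate
import Literature.MathematicalPhysics.QuantumLattice.DWaveSourceProofs
import Literature.MathematicalPhysics.QuantumLattice.InfVolFermionStateTorusLimitLocalStability
import HarnessLib

/-!
# Local stability of torus-limit ground states of the pair-sourced grand-canonical Hubbard model:
# `ω(Ã⋆[H^src_{Λ'}, Ã]) ≥ 0` for EVERY local `A`

Topic `Literature/MathematicalPhysics/QuantumLattice` (family `hubbard`); companion of
`InfVolFermionStateTorusLimitLocalStability.lean` (canonical limits of the nearest-neighbour model,
gauge-invariant `A` only), `InfVolFermionStateTorusLimitChargedStability.lean` (canonical limits of the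
`t–t'` model, charged `A` at the price of a sector-energy difference) and
`DWaveSourceWindowCertificate.lean` (energy soundness for the sourced torus). Here the Hamiltonian is the
pair-sourced GRAND-CANONICAL torus Hamiltonian `A_L = H_L(1,U) − μ N_L − h (Δ_d + Δ_d†)`
(`dWaveSourceTorus L U μ h`, Koma–Tasaki 1994 §1; `h = 0` is the grand-canonical Hubbard torus
`hubbardTorusWith 2 L 1 U μ`), and the states are GROUND-STATE VECTORS of `A_L` on the whole Fock space
(`A_L φ = E₀(A_L) φ`, `E₀ = Matrix.groundEnergy`). Because the ground energy is the minimum over the WHOLE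
space, the Bratteli–Robinson ground-state inequality holds for every local perturbation, charged or not,
with no chemical-potential correction (the `−μN` term is part of `A_L`):

* `expect_fermionEmbed_localStability_dWaveSource_nonneg` — finite volume, one ground-state vector `φ`
  of `A_L`, a region `Λ` with a window `Λ' ⊇ Λ` containing the lattice neighbours of `Λ` and fitting into
  the torus: `⟨φ, Γ(Ã⋆ [H^src_{Λ'}, Ã]) φ⟩ ≥ 0` for EVERY `A ∈ 𝔄_Λ`
  (`H^src_{Λ'} = pairSourceWindowHamiltonian dWaveFormFactor Λ' U μ h`; the torus commutator is the embedded
  window commutator, `dWaveSourceTorus_commutator_fermionEmbed`);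
* `torusAvgExpectAt_localStability_dWaveSource_nonneg` — the translation average (translates of ground-state
  vectors are ground-state vectors, `fockTranslate_mul_dWaveSourceTorus`);
* `InfVolFermionState.IsTorusLimitOf.localStability_dWaveSource` — for every torus limit `ω` of the
  translation averages of ground-state vectors `ψ_{Ls j}` of `A_{Ls j}`, `Ls → ∞`:
  `0 ≤ ω(Ã⋆ [H^src_{Λ'}, Ã])` for every local `A` — the licence for ground-state-positivity ("kkt") rows of
  certified-observable relaxations of the SOURCED model (cell `hubbard-obs`, TARGET §4 F-B), and, at
  `h = 0`, local stability of torus limits of grand-canonical Hubbard ground states for ALL local `A`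
  (the "flavour (β)" licence: no `μ`-bracket is needed because `μ` is in the Hamiltonian; what such a
  state class does NOT fix is the density, which is only constrained to `[n₋(μ), n₊(μ)]`).

Everything is PROVED; no definition, no named fact. HONEST SCOPE: `t' = 0` (the sourced objects of the tree
are nearest-neighbour); vector ground states (the tracial ground-state functional is a convex combination of
these, so the inequality transfers by linearity — not restated); nothing here bears on whether the Hubbard
model has `d`-wave order.

## References
* O. Bratteli, D. W. Robinson, *Operator Algebras and Quantum Statistical Mechanics 2*, 2nd ed.
  (Springer 1997), Def. 5.3.18, Prop. 5.3.19, Prop. 5.3.25. [cite: BratteliRobinsonII1997, Prop. 5.3.19]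
* T. Koma, H. Tasaki, J. Stat. Phys. 76 (1994) 745, §1 (the symmetry-breaking source `H_Λ − h O_Λ`).
  [cite: KomaTasaki1994, §1]
* M. Araújo, I. Klep, A. J. P. Garner, T. Vértesi, M. Navascués, arXiv:2311.18707, §3.2 Prop. 11
  (state-optimality constraints). [cite: AraujoEtAl2023, §3.2 Prop. 11]
-/

noncomputable section

namespace Literature.MathematicalPhysics.QuantumLattice

open Matrix Finset HubbardWave0 _root_.Filter Literature.Probability.LatticeModels
open scoped _root_.Topology ComplexOrder

section Torus

variable (U μ h : ℝ)

/-- **Finite volume, one ground-state vector (sourced grand-canonical torus).** For `φ` with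
`A_L φ = E₀(A_L) φ`, a region `Λ ⊆ Λ'` whose lattice neighbours lie in `Λ'`, `x ↦ x mod L` injective on
`thicken Λ' 1`, and ANY local `A ∈ 𝔄_Λ`: `⟨φ, Γ(Ã⋆ [H^src_{Λ'}, Ã]) φ⟩ ≥ 0`
(`= ⟨Bφ, (A_L − E₀) Bφ⟩`, `B = Γ Ã`). [cite: BratteliRobinsonII1997, Prop. 5.3.19] -/
theorem expect_fermionEmbed_localStability_dWaveSource_nonneg {Λ Λ' : Finset (Site 2)} (hΛ : Λ ⊆ Λ')
    (hclosed : ∀ x ∈ Λ, ∀ i : Fin 2, x + unitVec i ∈ Λ' ∧ x - unitVec i ∈ Λ')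
    {L : ℕ} [NeZero L] (hInj : Set.InjOn (Torus.proj (d := 2) L) ↑(thicken Λ' 1))
    {φ : Fock (Orb (FermionTorus 2 L))}
    (hφ : dWaveSourceTorus L U μ h *ᵥ φ = (((dWaveSourceTorus L U μ h).groundEnergy : ℝ) : ℂ) • φ)
    (A : FermionOp Λ) :
    0 ≤ expect (fermionEmbed (PolySite.toTorusEmb L (hInj.mono (by exact_mod_cast subset_thicken Λ' 1)))
        ((fermionEmbed (PolySite.incl hΛ) A)ᴴ *
          (pairSourceWindowHamiltonian dWaveFormFactor Λ' U μ h * fermionEmbed (PolySite.incl hΛ) A -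
            fermionEmbed (PolySite.incl hΛ) A * pairSourceWindowHamiltonian dWaveFormFactor Λ' U μ h))) φ := by
  have hH : (dWaveSourceTorus L U μ h).IsHermitian :=
    dWaveSourceTorus_isHermitian L (isHermitian_hubbardTorusWith L 1 U μ) h
  rw [expect, fermionEmbed_mul, fermionEmbed_conjTranspose,
    ← dWaveSourceTorus_commutator_fermionEmbed L hΛ hclosed hInj U μ h A]
  have hφ' : dWaveSourceTorus L U μ h *ᵥ φ =
      (((dWaveSourceTorus L U μ h).minEnergyOn ⊤ : ℝ) : ℂ) • φ := by
    rw [minEnergyOn_top_holds hH]; exact hφ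
  exact star_dotProduct_conjTranspose_mul_commutator_mulVec_nonneg hH ⊤ (fun v _ => Submodule.mem_top)
    Submodule.mem_top hφ'

/-- **Finite volume, translation average (sourced grand-canonical torus).** The translation-averaged
torus expectation of `Ã⋆[H^src_{Λ'}, Ã]` in a ground-state vector of `A_L` is `≥ 0` (translates of
ground-state vectors are ground-state vectors, `fockTranslate_mul_dWaveSourceTorus`).
[cite: BratteliRobinsonII1997, Prop. 5.3.19] -/
theorem torusAvgExpectAt_localStability_dWaveSource_nonneg {Λ Λ' : Finset (Site 2)} (hΛ : Λ ⊆ Λ')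
    (hclosed : ∀ x ∈ Λ, ∀ i : Fin 2, x + unitVec i ∈ Λ' ∧ x - unitVec i ∈ Λ')
    {L : ℕ} [NeZero L] (hInj : Set.InjOn (Torus.proj (d := 2) L) ↑(thicken Λ' 1))
    {ψ : Fock (Orb (FermionTorus 2 L))}
    (hψ : dWaveSourceTorus L U μ h *ᵥ ψ = (((dWaveSourceTorus L U μ h).groundEnergy : ℝ) : ℂ) • ψ)
    (A : FermionOp Λ) :
    0 ≤ torusAvgExpectAt L Λ'
        ((fermionEmbed (PolySite.incl hΛ) A)ᴴ *
          (pairSourceWindowHamiltonian dWaveFormFactor Λ' U μ h * fermionEmbed (PolySite.incl hΛ) A -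
            fermionEmbed (PolySite.incl hΛ) A * pairSourceWindowHamiltonian dWaveFormFactor Λ' U μ h)) ψ := by
  have h₁ : Set.InjOn (Torus.proj (d := 2) L) ↑Λ' := hInj.mono (by exact_mod_cast subset_thicken Λ' 1)
  rw [torusAvgExpectAt_of_injOn L h₁]
  have hgs : ∀ v : TorusSite 2 L, dWaveSourceTorus L U μ h *ᵥ ((fockTranslate v).val *ᵥ ψ) =
      (((dWaveSourceTorus L U μ h).groundEnergy : ℝ) : ℂ) • ((fockTranslate v).val *ᵥ ψ) := by
    intro v
    rw [mulVec_mulVec, ← fockTranslate_mul_dWaveSourceTorus L v U μ h, ← mulVec_mulVec, hψ, mulVec_smul]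
  have hsum : (0 : ℂ) ≤ ∑ v : TorusSite 2 L, expect (fermionEmbed (PolySite.toTorusEmb L h₁)
      ((fermionEmbed (PolySite.incl hΛ) A)ᴴ *
          (pairSourceWindowHamiltonian dWaveFormFactor Λ' U μ h * fermionEmbed (PolySite.incl hΛ) A -
            fermionEmbed (PolySite.incl hΛ) A * pairSourceWindowHamiltonian dWaveFormFactor Λ' U μ h)))
      ((fockTranslate v).val *ᵥ ψ) :=
    Finset.sum_nonneg fun v _ =>
      expect_fermionEmbed_localStability_dWaveSource_nonneg U μ h hΛ hclosed hInj (hgs v) A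
  obtain ⟨hre, him⟩ := Complex.nonneg_iff.1 hsum
  rw [show ((Fintype.card (TorusSite 2 L) : ℂ))⁻¹ = (((Fintype.card (TorusSite 2 L) : ℝ)⁻¹ : ℝ) : ℂ) by
    push_cast; rfl, Complex.nonneg_iff, Complex.re_ofReal_mul, Complex.im_ofReal_mul, ← him, mul_zero]
  exact ⟨mul_nonneg (inv_nonneg.2 (Nat.cast_nonneg _)) hre, rfl⟩

/-- **Local stability of torus-limit ground states of the pair-sourced grand-canonical Hubbard model, for
EVERY local perturbation.** Let `ω` be a torus limit of the translation averages of ground-state vectors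
`ψ_{Ls j}` of `A_{Ls j} = dWaveSourceTorus (Ls j) U μ h`, `Ls → ∞`. Then for every region `Λ`, every window
`Λ' ⊇ Λ` containing the lattice neighbours of `Λ`, and EVERY local `A ∈ 𝔄_Λ` (charged or not),
`0 ≤ ω(Ã⋆ [H^src_{Λ'}, Ã])`. At `h = 0` this is local stability of torus limits of grand-canonical Hubbard
ground states with the chemical potential inside the Hamiltonian. Bratteli–Robinson II Prop. 5.3.25;
Koma–Tasaki 1994 §1 for the sourced Hamiltonian. [cite: BratteliRobinsonII1997, Prop. 5.3.25] -/
theorem InfVolFermionState.IsTorusLimitOf.localStability_dWaveSource {ω : InfVolFermionState 2}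
    {ψ : ∀ L, Fock (Orb (FermionTorus 2 L))} {Ls : ℕ → ℕ} (hω : ω.IsTorusLimitOf ψ Ls)
    (hLs : Tendsto Ls atTop atTop)
    (hgs : ∀ (j : ℕ) [NeZero (Ls j)], dWaveSourceTorus (Ls j) U μ h *ᵥ ψ (Ls j) =
      (((dWaveSourceTorus (Ls j) U μ h).groundEnergy : ℝ) : ℂ) • ψ (Ls j))
    {Λ Λ' : Finset (Site 2)} (hΛ : Λ ⊆ Λ')
    (hclosed : ∀ x ∈ Λ, ∀ i : Fin 2, x + unitVec i ∈ Λ' ∧ x - unitVec i ∈ Λ') (A : FermionOp Λ) :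
    0 ≤ ω.expect Λ'
        ((fermionEmbed (PolySite.incl hΛ) A)ᴴ *
          (pairSourceWindowHamiltonian dWaveFormFactor Λ' U μ h * fermionEmbed (PolySite.incl hΛ) A -
            fermionEmbed (PolySite.incl hΛ) A * pairSourceWindowHamiltonian dWaveFormFactor Λ' U μ h)) := by
  refine ge_of_tendsto (hω Λ' _) ?_
  filter_upwards [eventually_injOn_proj_of_tendsto (thicken Λ' 1) hLs, hLs.eventually_ge_atTop 1] with j hInj hj
  haveI : NeZero (Ls j) := ⟨by omega⟩
  rw [torusAvgExpect_eq]
  exact torusAvgExpectAt_localStability_dWaveSource_nonneg U μ h hΛ hclosed hInj (hgs j) A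

end Torus

end Literature.MathematicalPhysics.QuantumLattice

end
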